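import Summits.ResolutionOfSingularities.ResolutionOfSingularities.Theorems.FrobeniusClosingPatchingRelPerfectDepthPhaseCCarrierRsop
import Literature.AlgebraicGeometry.Resolution.AlterationsSectionDivisor
import Literature.AlgebraicGeometry.Resolution.NormalCrossingsBlowupStepReduction
import HarnessLib

/-!
# Crux `PatchingRelPerfect` (stmt-ResolutionOfSingularities-16161), chain W5.2 — F7(β) (β-AX) X3, LEMMA E at the STALK of the carrier
# subscheme: `(g, f₁, …, f_n)` is part of an r.s.o.p. of `𝒪_{X,x}` iff the images of the `fᵢ` in `𝒪_{V(I),z}` are, `I_x = (g)`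

[OURS · L1 W5.2 · F7(β) (β-AX) X3 `PhaseCTermination₂` / T2c · res-L1-w52-idea-1 X3 MEASURE MEMO §1 LEMMA E; res-L1-w52-plan-1 RULING G11-14 (1),
G11-17 (6)] res-L1-w52-stub-1 g5.  Replaces the role of NO printed item; NOT a statement of the manuscript under review (AI-written, weaker
than expert review).  The scheme-stalk packaging of `…DepthPhaseCCarrierRsop` (`isRsopPart_cons_iff`): for an ideal sheaf `I` on a scheme
`X`, a point `z` of the closed subscheme `V(I)` with image `x`, and a generator `g` of the stalk `I_x = (g)`:

* `nonempty_stalk_quotient_ringEquiv` — `𝒪_{X,x} ⧸ (g) ≃+* 𝒪_{V(I),z}` carrying `ā` to the image of `a` under the stalk map of the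
  closed immersion `V(I) ↪ X` (`Scheme.Hom.stalkMap_surjective`, `stalkIdeal_ker_eq_ker_stalkMap`, `ker_subschemeι`);
* **`isRsopPart_cons_iff_stalkMap`** — for `𝒪_{X,x}` regular and `g ≠ 0`: `(g, f₁, …, f_n)` is part of a regular system of parameters of
  `𝒪_{X,x}` iff `(f̄₁, …, f̄_n)` (images under the stalk map) is part of a regular system of parameters of `𝒪_{V(I),z}`.

This is how strict END (A1 `IsFormatSncOn`: members and ALL hosts through a point form ONE regular system of parameters) is read on the
carrier `G = V(I)` of a bare host and transported back (Lemma R / Lemma E of the X3 memo; T2c's «carrier section adjoined»).  Fact-free.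

## References
* H. Matsumura, *Commutative Ring Theory*, CUP 1986, Thm. 14.2. [Matsumura1987]
* The Stacks Project, Tag 01HJ (closed immersions and stalks), Tag 00NQ. [StacksProject]
-/

-- `Summit.<Summit>.<Sub>.Theorems` with `Sub = Summit` (single-conjunct summit, D-0017)
set_option linter.dupNamespace false

noncomputable section

open CategoryTheory AlgebraicGeometry IsLocalRing

namespace Literature.AlgebraicGeometry.Resolution

universe u

variable {X : Scheme.{u}} (I : X.IdealSheafData) (z : I.subscheme)

/-- **The stalk of the closed subscheme is the quotient of the ambient stalk by the stalk ideal**: for `I_x = (g)` (`x` the image of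
`z`), `𝒪_{X,x} ⧸ (g) ≃+* 𝒪_{V(I),z}`, compatible with the quotient map and the stalk map. [cite: StacksProject, Tag 01HJ] -/
theorem nonempty_stalk_quotient_ringEquiv {g : X.presheaf.stalk (I.subschemeι z)}
    (hg : stalkIdeal I (I.subschemeι z) = Ideal.span {g}) :
    ∃ e : (X.presheaf.stalk (I.subschemeι z) ⧸ Ideal.span {g}) ≃+* I.subscheme.presheaf.stalk z,
      ∀ a, e (Ideal.Quotient.mk _ a) = (I.subschemeι.stalkMap z).hom a := by
  have hsurj : Function.Surjective (I.subschemeι.stalkMap z).hom := I.subschemeι.stalkMap_surjective z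
  have hker : RingHom.ker (I.subschemeι.stalkMap z).hom = Ideal.span {g} := by
    rw [← hg, ← stalkIdeal_ker_eq_ker_stalkMap I.subschemeι z, Scheme.IdealSheafData.ker_subschemeι]
  refine ⟨(Ideal.quotEquivOfEq hker.symm).trans (RingHom.quotientKerEquivOfSurjective hsurj), fun a => ?_⟩
  rw [RingEquiv.trans_apply, Ideal.quotEquivOfEq_mk]
  exact RingHom.quotientKerEquivOfSurjective_apply_mk hsurj a

/-- [OURS · L1 W5.2 · X3 Lemma E, scheme stalk] **Lemma E at the stalk of the carrier subscheme.** `I_x = (g)` with `g ≠ 0` and `𝒪_{X,x}`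
regular (`x` the image of `z ∈ V(I)`): `(g, f₁, …, f_n)` is part of a regular system of parameters of `𝒪_{X,x}` iff the images `f̄ᵢ` under
the stalk map `𝒪_{X,x} → 𝒪_{V(I),z}` are part of a regular system of parameters of `𝒪_{V(I),z}`. [cite: Matsumura1987, Thm. 14.2] -/
theorem isRsopPart_cons_iff_stalkMap [IsRegularLocalRing (X.presheaf.stalk (I.subschemeι z))]
    {g : X.presheaf.stalk (I.subschemeι z)} (hg : stalkIdeal I (I.subschemeι z) = Ideal.span {g}) (hg0 : g ≠ 0)
    {n : ℕ} (f : Fin n → X.presheaf.stalk (I.subschemeι z)) :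
    IsRsopPart (Fin.cons g f : Fin (n + 1) → X.presheaf.stalk (I.subschemeι z)) ↔
      IsRsopPart fun i => (I.subschemeι.stalkMap z).hom (f i) := by
  -- `(g) ≠ ⊤`: `x` lies in the support of `I`
  have hx : (I.subschemeι z : X) ∈ (I.support : Set X) := by
    rw [← Scheme.IdealSheafData.range_subschemeι]
    exact ⟨z, rfl⟩
  have hne : Ideal.span {g} ≠ ⊤ := by
    rw [← hg]
    intro h
    have hle := (mem_support_iff_stalkIdeal_le I _).mp hx
    rw [h, top_le_iff] at hle
    exact (maximalIdeal.isMaximal _).ne_top hle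
  haveI : IsLocalRing (X.presheaf.stalk (I.subschemeι z) ⧸ Ideal.span {g}) := isLocalRing_quotient hne
  obtain ⟨e, he⟩ := nonempty_stalk_quotient_ringEquiv I z hg
  rw [isRsopPart_cons_iff hg0]
  have hcomp : (fun i => (I.subschemeι.stalkMap z).hom (f i)) = e ∘ fun i => Ideal.Quotient.mk (Ideal.span {g}) (f i) := by
    funext i
    exact (he (f i)).symm
  constructor
  · intro h
    rw [hcomp]
    exact h.map_ringEquiv e
  · intro h
    have h' := h.map_ringEquiv e.symm
    have hcomp' : (e.symm ∘ fun i => (I.subschemeι.stalkMap z).hom (f i)) =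
        fun i => Ideal.Quotient.mk (Ideal.span {g}) (f i) := by
      funext i
      simp only [Function.comp_apply, ← he, RingEquiv.symm_apply_apply]
    rwa [hcomp'] at h'

end Literature.AlgebraicGeometry.Resolution

end
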